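import Summits.FinalStateConjecture.FinalStateConjecture.Theses.PhotonSphereChannels
import Summits.FinalStateConjecture.FinalStateConjecture.Theses.SwallowTheDatum
import Literature.Geometry.Lorentzian.KerrSchild
import Literature.Geometry.Lorentzian.KerrDataProofs
import Literature.Geometry.Lorentzian.KerrSchildCoord
import Literature.Geometry.Lorentzian.LorentzianDistance
import Literature.Geometry.Lorentzian.Hypersurface
import Literature.Geometry.Lorentzian.Einstein
import Literature.Geometry.Lorentzian.LeviCivitaProofs
import Literature.Geometry.Lorentzian.CausalityProofs
import Literature.Geometry.Lorentzian.CausalityPushUp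

/-!
# Negative note (drefute, line `crush-the-swallowed-interior`, crux stmt-FinalStateConjecture-10047):
`IsCrushable` and `NullTerminality` collapse, because the vendored `futureCauchyDevelopment`
of a closed set is the set itself

`LorentzianMetric.futureCauchyDevelopment` (`Literature/Geometry/Lorentzian/Causality.lean`, l. 628)
quantifies over past-inextendible causal curves in the VENDORED sense
`IsPastInextendible γ s := s.Nonempty ∧ (¬ BddBelow s ∨ ¬ ∃ p, Tendsto γ (𝓝[>] sInf s) (𝓝 p))`, which
the same file (section "Endpoints, endless curves and Cauchy hypersurfaces (faithful notions)",
l. 706 ff.) records as mis-formalised: a curve on a parameter set unbounded below is "past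
inextendible" whatever its endpoints. Hence (§1) `D⁺(S) = S` for every closed `S`, and a closed
achronal `S` with `J⁺(S) ⊆ D⁺(S)` is EMPTY. Consequences for the skeleton (§2, with the skeleton's
`swallowed`, `IsCrushable`, `NullTerminality` copied VERBATIM into this namespace):

* `isCrushable_iff_exists_isCompact_superset`: `IsCrushable 𝒟 K ↔ ∃ C, IsCompact C ∧ J⁺(ι '' K) ⊆ C`
  — the crush hypersurface of any witness is empty (`IsCrushable.isEmpty_surface`), and conversely the
  empty `3`-manifold witnesses `IsCrushable` as soon as the swallowed region is relatively compact.
  For a nonempty core `K` in a (maximal) Cauchy development `J⁺(ι '' K)` contains a future-endless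
  timelike curve and is never relatively compact (non-imprisonment), so the hypothesis of `stub_crush`
  is never met in the intended situation and the composition `TameCensorship_of` always runs through
  `stub_residue`'s conjunct `¬ IsCrushable → NoOrbitSwallowed ∧ SwallowedRaysTame`.
* `nullTerminality_iff_inSurface`: `NullTerminality` is equivalent to the statement obtained by
  replacing "`γ` eventually in `D⁺(range f)`" by "`γ` eventually IN `range f`" (a null geodesic lying
  inside the closed spacelike hypersurface on a parameter interval) — not the intended null companion
  of Hawking's bound.

REPAIR (for the planner/lead): in `IsCrushable` and `NullTerminality` replace
`𝒟.metric.futureCauchyDevelopment 𝒟.timeOrientation (Set.range f)` by the faithful future domain of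
dependence built on `IsPastEndless` (Causality.lean, faithful notions), e.g.
`{p | ∀ γ s, s.OrdConnected → g.IsFutureCausalCurveOn τ γ s → IsPastEndless γ s →
   ∀ t₀ ∈ s, γ t₀ = p → ∃ t ∈ s, t ≤ t₀ ∧ γ t ∈ S}`.
-/

set_option linter.dupNamespace false

noncomputable section

open Set Filter Function Bundle
open scoped Manifold ContDiff Topology ENNReal NNReal

namespace Literature.Geometry.Lorentzian.LorentzianMetric

/-! ## §1 The vendored `D⁺` of a closed set is the set itself -/

section General

variable {E : Type*} [NormedAddCommGroup E] [NormedSpace ℝ E] {H : Type*} [TopologicalSpace H]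
  {I : ModelWithCorners ℝ E H} {n : ℕ∞ω} {M : Type*} [TopologicalSpace M] [ChartedSpace H M]
  [IsManifold I ∞ M]

/-- **Junk theorem.** On a manifold without boundary, the vendored future Cauchy development of a
CLOSED set `S` is `S` itself: `D⁺(S) = S`. Proof: if `p ∈ D⁺(S) ∖ S`, the local cone lemma gives a
future timelike segment `γ : [0, 1] → M` ending at `γ 1 = p`; by continuity its tail lies in the
open set `Sᶜ`; reparametrised by `ψ u = 1 - δ' (1 - exp u)` over `(-∞, 0]` it is a future causal
curve on `Iic 0`, "past-inextendible" because `Iic 0` is unbounded below, through `p` at `u = 0`,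
and it misses `S` — contradicting `p ∈ D⁺(S)`. -/
theorem futureCauchyDevelopment_eq_self_of_isClosed [BoundarylessManifold I M]
    (g : LorentzianMetric I n M) (τ : TimeOrientation g) {S : Set M} (hS : IsClosed S) :
    g.futureCauchyDevelopment τ S = S := by
  refine Set.Subset.antisymm (fun p hp ↦ ?_) (subset_futureCauchyDevelopment S)
  by_contra hpS
  obtain ⟨q', U, hU, hcurve⟩ := g.exists_nhds_forall_isFutureTimelikeCurveOn_from τ
    (BoundarylessManifold.isInteriorPoint (I := I) (x := p))
  obtain ⟨γ, hγ, -, hγ1⟩ := hcurve p (mem_of_mem_nhds hU)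
  have hcont : ContinuousAt γ 1 := (hγ 1 ⟨zero_le_one, le_rfl⟩).1.continuousAt
  have hSc : Sᶜ ∈ 𝓝 (γ 1) := by
    rw [hγ1]
    exact hS.isOpen_compl.mem_nhds hpS
  obtain ⟨δ, hδ, hδS⟩ : ∃ δ > 0, ∀ t : ℝ, dist t 1 < δ → γ t ∈ Sᶜ := by
    obtain ⟨δ, hδ, h⟩ := Metric.mem_nhds_iff.mp (hcont.preimage_mem_nhds hSc)
    exact ⟨δ, hδ, fun t ht ↦ h ht⟩
  set δ' : ℝ := min δ 1 / 2 with hδ'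
  have hδ'pos : 0 < δ' := by
    have : 0 < min δ 1 := lt_min hδ one_pos
    positivity
  have hδ'lt : δ' < δ := by
    have h1 : min δ 1 ≤ δ := min_le_left _ _
    rw [hδ']
    linarith
  have hδ'le : δ' ≤ 1 / 2 := by
    have h1 : min δ 1 ≤ 1 := min_le_right _ _
    rw [hδ']
    linarith
  set ψ : ℝ → ℝ := fun u ↦ 1 - δ' * (1 - Real.exp u) with hψ
  have hψ' : ∀ u, HasDerivAt ψ (δ' * Real.exp u) u := fun u ↦ by
    have h := ((Real.hasDerivAt_exp u).const_sub 1).const_mul δ'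
    have h2 : HasDerivAt ψ (-(δ' * -Real.exp u)) u := h.const_sub 1
    exact h2.congr_deriv (by ring)
  have hψpos : ∀ u, 0 < δ' * Real.exp u := fun u ↦ mul_pos hδ'pos (Real.exp_pos u)
  have hψmem : ∀ u : ℝ, u ≤ 0 → ψ u ∈ Icc (0 : ℝ) 1 ∧ dist (ψ u) 1 < δ := by
    intro u hu
    have he0 : 0 < Real.exp u := Real.exp_pos u
    have he1 : Real.exp u ≤ 1 := by simpa using Real.exp_le_exp.mpr hu
    have h1 : 0 ≤ δ' * (1 - Real.exp u) := mul_nonneg hδ'pos.le (by linarith)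
    have h2 : δ' * (1 - Real.exp u) < δ' := by nlinarith
    refine ⟨⟨?_, ?_⟩, ?_⟩
    · simp only [hψ]; linarith
    · simp only [hψ]; linarith
    · rw [Real.dist_eq]
      simp only [hψ]
      rw [show 1 - δ' * (1 - Real.exp u) - 1 = -(δ' * (1 - Real.exp u)) by ring, abs_neg,
        abs_of_nonneg h1]
      linarith
  have hγψ : g.IsFutureTimelikeCurveOn τ (γ ∘ ψ) (Iic 0) :=
    (hγ.comp_of_hasDerivAt hψ' hψpos).mono fun u hu ↦ (hψmem u hu).1
  have hψ0 : (γ ∘ ψ) 0 = p := by simp [hψ, hγ1]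
  obtain ⟨t, ht, -, htS⟩ := hp (γ ∘ ψ) (Iic 0) ordConnected_Iic hγψ.isFutureCausalCurveOn
    ⟨⟨0, Set.self_mem_Iic⟩, Or.inl (not_bddBelow_Iic 0)⟩ 0 Set.self_mem_Iic hψ0
  exact hδS _ (hψmem t ht).2 htS

/-- Time dual: the vendored past Cauchy development of a closed set is the set itself. -/
theorem pastCauchyDevelopment_eq_self_of_isClosed [BoundarylessManifold I M]
    (g : LorentzianMetric I n M) (τ : TimeOrientation g) {S : Set M} (hS : IsClosed S) :
    g.pastCauchyDevelopment τ S = S :=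
  futureCauchyDevelopment_eq_self_of_isClosed g τ.reverse hS

/-- Hence the vendored (two-sided) Cauchy development of a closed set is the set itself. -/
theorem cauchyDevelopment_eq_self_of_isClosed [BoundarylessManifold I M]
    (g : LorentzianMetric I n M) (τ : TimeOrientation g) {S : Set M} (hS : IsClosed S) :
    g.cauchyDevelopment τ S = S := by
  rw [cauchyDevelopment, futureCauchyDevelopment_eq_self_of_isClosed g τ hS,
    pastCauchyDevelopment_eq_self_of_isClosed g τ hS, Set.union_self]

/-- **A closed achronal set whose causal future lies in its vendored `D⁺` is EMPTY**: every `p ∈ S`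
has a point `q⁺ ∈ I⁺(p)` (local cone lemma, time dual), and `q⁺ ∈ I⁺(S) ⊆ J⁺(S) ⊆ D⁺(S) = S`
contradicts achronality. -/
theorem eq_empty_of_isClosed_of_isAchronal_of_causalFuture_subset [BoundarylessManifold I M]
    (g : LorentzianMetric I n M) (τ : TimeOrientation g) {S : Set M} (hS : IsClosed S)
    (hach : g.IsAchronal τ S)
    (hdep : g.causalFuture τ S ⊆ g.futureCauchyDevelopment τ S) : S = ∅ := by
  rw [futureCauchyDevelopment_eq_self_of_isClosed g τ hS] at hdep
  refine Set.eq_empty_of_forall_notMem fun p hp ↦ ?_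
  obtain ⟨q', U, hU, hUq⟩ := g.exists_nhds_subset_chronologicalPast τ
    (BoundarylessManifold.isInteriorPoint (I := I) (x := p))
  have hq' : q' ∈ g.chronologicalFuture τ {p} :=
    mem_chronologicalFuture_of_mem_chronologicalPast (hUq (mem_of_mem_nhds hU))
  have hq'S : q' ∈ S :=
    hdep (g.chronologicalFuture_subset_causalFuture τ S
      (chronologicalFuture_mono (Set.singleton_subset_iff.mpr hp) hq'))
  exact hach p hp q' hq'S hq'

end General

end Literature.Geometry.Lorentzian.LorentzianMetric

/-! ## §2 Consequences for the skeleton's `IsCrushable` and `NullTerminality` (verbatim copies) -/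

namespace Summit.FinalStateConjecture.FinalStateConjecture.Cruxes.TameCensorship.CrushTheSwallowedInterior.NegativeNotes

open Literature.Geometry.Lorentzian

section Crush

variable {X : Type} [TopologicalSpace X] [ChartedSpace E3 X] [IsManifold (𝓡 3) ∞ X] [T2Space X]
  [SecondCountableTopology X] [ConnectedSpace X]

/-- VERBATIM copy of the skeleton's `swallowed`. -/
def swallowed {D : InitialDataSet (𝓡 3) X} (𝒟 : VacuumCauchyDevelopment D) (K : Set X) :
    Set 𝒟.carrier :=
  𝒟.metric.causalFuture 𝒟.timeOrientation (𝒟.embed '' K)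

/-- VERBATIM copy of the skeleton's `IsCrushable`. -/
def IsCrushable {D : InitialDataSet (𝓡 3) X} (𝒟 : VacuumCauchyDevelopment D) [𝒟.metric.HasLeviCivita]
    (K : Set X) : Prop :=
  ∃ (N : Type) (_ : TopologicalSpace N) (_ : ChartedSpace E3 N) (_ : IsManifold (𝓡 3) ∞ N)
    (f : N → 𝒟.carrier)
    (hpb : PseudoRiemannianMetric.contMDiff_pullbackBilin (𝓡 4) 𝒟.carrier (𝓡 3) N ∞)
    (hf : 𝒟.metric.IsSpacelikeImmersion (𝓡 3) f) (ν : NormalField (𝓡 4) f) (ε : ℝ),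
    0 < ε ∧
    ContMDiff (𝓡 3) (𝓡 4).tangent ∞
      (fun y ↦ (TotalSpace.mk' E4 (f y) (ν y) : TangentBundle (𝓡 4) 𝒟.carrier)) ∧
    𝒟.metric.IsFutureUnitNormal (𝓡 3) 𝒟.timeOrientation f ν ∧
    (∀ y, 𝒟.metric.meanCurvature f hpb hf ν y ≤ -ε) ∧
    IsClosed (Set.range f) ∧ 𝒟.metric.IsAchronal 𝒟.timeOrientation (Set.range f) ∧
    𝒟.metric.causalFuture 𝒟.timeOrientation (Set.range f) ⊆
      𝒟.metric.futureCauchyDevelopment 𝒟.timeOrientation (Set.range f) ∧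
    ∃ C : Set 𝒟.carrier, IsCompact C ∧
      swallowed 𝒟 K ⊆ C ∪ 𝒟.metric.chronologicalFuture 𝒟.timeOrientation (Set.range f)

omit [T2Space X] [SecondCountableTopology X] in
/-- **The crush hypersurface of any `IsCrushable` witness is empty**: its image is closed, achronal
and satisfies `J⁺ ⊆ D⁺` (vendored), hence is `∅` (§1). -/
theorem isEmpty_of_crush_clauses {D : InitialDataSet (𝓡 3) X} (𝒟 : VacuumCauchyDevelopment D)
    {N : Type} (f : N → 𝒟.carrier) (hclosed : IsClosed (Set.range f))
    (hach : 𝒟.metric.IsAchronal 𝒟.timeOrientation (Set.range f))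
    (hdep : 𝒟.metric.causalFuture 𝒟.timeOrientation (Set.range f) ⊆
      𝒟.metric.futureCauchyDevelopment 𝒟.timeOrientation (Set.range f)) : IsEmpty N := by
  have h := LorentzianMetric.eq_empty_of_isClosed_of_isAchronal_of_causalFuture_subset
    𝒟.metric 𝒟.timeOrientation hclosed hach hdep
  rw [Set.range_eq_empty_iff] at h
  exact h

omit [T2Space X] [SecondCountableTopology X] in
/-- `IsCrushable 𝒟 K` forces the swallowed region `J⁺(ι '' K)` to be relatively compact (the
chronological future of the — empty — crush hypersurface is empty). -/
theorem IsCrushable.exists_isCompact_superset {D : InitialDataSet (𝓡 3) X}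
    {𝒟 : VacuumCauchyDevelopment D} [𝒟.metric.HasLeviCivita] {K : Set X}
    (h : IsCrushable 𝒟 K) : ∃ C : Set 𝒟.carrier, IsCompact C ∧ swallowed 𝒟 K ⊆ C := by
  obtain ⟨N, _, _, _, f, hpb, hf, ν, ε, hε, hν, hunit, hH, hclosed, hach, hdep, C, hC, hsub⟩ := h
  haveI : IsEmpty N := isEmpty_of_crush_clauses 𝒟 f hclosed hach hdep
  refine ⟨C, hC, fun m hm ↦ ?_⟩
  rcases hsub hm with hmC | hmI
  · exact hmC
  · exfalso
    obtain ⟨p, hp, -⟩ := hmI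
    rw [Set.range_eq_empty f] at hp
    exact hp

/-- The empty open subset of `E3`, an empty smooth `3`-manifold. -/
abbrev EmptyThreefold : Type := (⊥ : TopologicalSpace.Opens E3)

instance : IsEmpty EmptyThreefold :=
  ⟨fun y ↦ (y.2 : y.1 ∈ ((⊥ : TopologicalSpace.Opens E3) : Set E3))⟩

omit [T2Space X] [SecondCountableTopology X] in
/-- Conversely, a relatively compact swallowed region makes `IsCrushable 𝒟 K` true with the EMPTY
crush hypersurface (`N = ⊥ ⊆ E3`, `ε = 1`): every hypersurface clause is vacuous, `range f = ∅` is
closed and achronal, `J⁺(∅) = ∅ ⊆ D⁺(∅)`. -/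
theorem isCrushable_of_exists_isCompact_superset {D : InitialDataSet (𝓡 3) X}
    {𝒟 : VacuumCauchyDevelopment D} [𝒟.metric.HasLeviCivita] {K : Set X}
    (h : ∃ C : Set 𝒟.carrier, IsCompact C ∧ swallowed 𝒟 K ⊆ C) : IsCrushable 𝒟 K := by
  obtain ⟨C, hC, hsub⟩ := h
  have hpb : PseudoRiemannianMetric.contMDiff_pullbackBilin (𝓡 4) 𝒟.carrier (𝓡 3)
      EmptyThreefold ∞ := by
    intro _ _ _ _ _ y
    exact isEmptyElim y
  have hrange : Set.range (fun y : EmptyThreefold ↦ (isEmptyElim y : 𝒟.carrier)) = ∅ :=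
    Set.range_eq_empty _
  refine ⟨EmptyThreefold, inferInstance, inferInstance, inferInstance,
    fun y ↦ isEmptyElim y, hpb, ⟨fun y ↦ isEmptyElim y, fun y ↦ isEmptyElim y⟩,
    fun y ↦ isEmptyElim y, 1, one_pos, fun y ↦ isEmptyElim y,
    ⟨⟨fun y ↦ isEmptyElim y, fun y ↦ isEmptyElim y⟩, fun y ↦ isEmptyElim y⟩,
    fun y ↦ isEmptyElim y, ?_, ?_, ?_, C, hC, fun m hm ↦ Or.inl (hsub hm)⟩
  · rw [hrange]; exact isClosed_empty
  · rw [hrange]; intro p hp; exact hp.elim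
  · rw [hrange]
    intro q hq
    rcases hq with hq | ⟨p, hp, -⟩
    · exact hq.elim
    · exact hp.elim

omit [T2Space X] [SecondCountableTopology X] in
/-- **`IsCrushable` is relative compactness of the swallowed region** (and nothing about a crush
hypersurface). For a nonempty core `K` of a Cauchy development `J⁺(ι '' K)` is never relatively
compact (it contains a future-endless timelike curve; non-imprisonment in the strongly causal
development), so in the intended situation `IsCrushable 𝒟 (range φ)ᶜ` is FALSE for every buried
member and `TameCensorship_of` always falls through to `stub_residue`. -/
theorem isCrushable_iff_exists_isCompact_superset {D : InitialDataSet (𝓡 3) X}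
    {𝒟 : VacuumCauchyDevelopment D} [𝒟.metric.HasLeviCivita] {K : Set X} :
    IsCrushable 𝒟 K ↔ ∃ C : Set 𝒟.carrier, IsCompact C ∧ swallowed 𝒟 K ⊆ C :=
  ⟨IsCrushable.exists_isCompact_superset, isCrushable_of_exists_isCompact_superset⟩

omit [T2Space X] [SecondCountableTopology X] in
/-- In particular the empty core is always "crushable". -/
theorem isCrushable_empty {D : InitialDataSet (𝓡 3) X} (𝒟 : VacuumCauchyDevelopment D)
    [𝒟.metric.HasLeviCivita] : IsCrushable 𝒟 (∅ : Set X) :=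
  isCrushable_of_exists_isCompact_superset ⟨∅, isCompact_empty, by
    intro m hm
    rcases hm with hm | ⟨p, hp, -⟩
    · simp at hm
    · simp at hp⟩

end Crush

/-- VERBATIM copy of the skeleton's `NullTerminality`. -/
def NullTerminality : Prop :=
  ∀ (Y : Type) [TopologicalSpace Y] [ChartedSpace E3 Y] [IsManifold (𝓡 3) ∞ Y] [T2Space Y]
    [SecondCountableTopology Y] [ConnectedSpace Y] (DY : InitialDataSet (𝓡 3) Y)
    (𝒟 : VacuumCauchyDevelopment DY), 𝒟.IsMaximal → ∀ [𝒟.metric.HasLeviCivita]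
    (N : Type) [TopologicalSpace N] [ChartedSpace E3 N] [IsManifold (𝓡 3) ∞ N] (f : N → 𝒟.carrier)
    (hpb : PseudoRiemannianMetric.contMDiff_pullbackBilin (𝓡 4) 𝒟.carrier (𝓡 3) N ∞)
    (hf : 𝒟.metric.IsSpacelikeImmersion (𝓡 3) f) (ν : NormalField (𝓡 4) f),
    ContMDiff (𝓡 3) (𝓡 4).tangent ∞
      (fun y ↦ (TotalSpace.mk' E4 (f y) (ν y) : TangentBundle (𝓡 4) 𝒟.carrier)) →
    𝒟.metric.IsFutureUnitNormal (𝓡 3) 𝒟.timeOrientation f ν →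
    IsClosed (Set.range f) → 𝒟.metric.IsAchronal 𝒟.timeOrientation (Set.range f) →
    ∀ ε : ℝ, 0 < ε → (∀ y, 𝒟.metric.meanCurvature f hpb hf ν y ≤ -ε) →
    ∀ (γ : ℝ → 𝒟.carrier) (dom : Set ℝ), IsMaximalGeodesicOn 𝒟.metric.leviCivita γ dom →
      (∃ t ∈ dom, 𝒟.metric.IsNull (velocity (𝓡 4) γ t) ∧
        𝒟.timeOrientation.IsFutureDirected (velocity (𝓡 4) γ t)) →
      (∃ t₀ ∈ dom, ∀ t ∈ dom, t₀ ≤ t →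
        γ t ∈ 𝒟.metric.futureCauchyDevelopment 𝒟.timeOrientation (Set.range f)) →
      BddAbove dom

/-- What `NullTerminality` LITERALLY says once `D⁺(range f) = range f` is unfolded: the geodesic
eventually lies INSIDE the hypersurface `range f`. -/
def NullTerminalityInSurface : Prop :=
  ∀ (Y : Type) [TopologicalSpace Y] [ChartedSpace E3 Y] [IsManifold (𝓡 3) ∞ Y] [T2Space Y]
    [SecondCountableTopology Y] [ConnectedSpace Y] (DY : InitialDataSet (𝓡 3) Y)
    (𝒟 : VacuumCauchyDevelopment DY), 𝒟.IsMaximal → ∀ [𝒟.metric.HasLeviCivita]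
    (N : Type) [TopologicalSpace N] [ChartedSpace E3 N] [IsManifold (𝓡 3) ∞ N] (f : N → 𝒟.carrier)
    (hpb : PseudoRiemannianMetric.contMDiff_pullbackBilin (𝓡 4) 𝒟.carrier (𝓡 3) N ∞)
    (hf : 𝒟.metric.IsSpacelikeImmersion (𝓡 3) f) (ν : NormalField (𝓡 4) f),
    ContMDiff (𝓡 3) (𝓡 4).tangent ∞
      (fun y ↦ (TotalSpace.mk' E4 (f y) (ν y) : TangentBundle (𝓡 4) 𝒟.carrier)) →
    𝒟.metric.IsFutureUnitNormal (𝓡 3) 𝒟.timeOrientation f ν →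
    IsClosed (Set.range f) → 𝒟.metric.IsAchronal 𝒟.timeOrientation (Set.range f) →
    ∀ ε : ℝ, 0 < ε → (∀ y, 𝒟.metric.meanCurvature f hpb hf ν y ≤ -ε) →
    ∀ (γ : ℝ → 𝒟.carrier) (dom : Set ℝ), IsMaximalGeodesicOn 𝒟.metric.leviCivita γ dom →
      (∃ t ∈ dom, 𝒟.metric.IsNull (velocity (𝓡 4) γ t) ∧
        𝒟.timeOrientation.IsFutureDirected (velocity (𝓡 4) γ t)) →
      (∃ t₀ ∈ dom, ∀ t ∈ dom, t₀ ≤ t → γ t ∈ Set.range f) →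
      BddAbove dom

/-- **`NullTerminality` as typed is the in-surface statement**, by §1. -/
theorem nullTerminality_iff_inSurface : NullTerminality ↔ NullTerminalityInSurface := by
  constructor
  · intro h Y _ _ _ _ _ _ DY 𝒟 hmax _ N _ _ _ f hpb hf ν hν hunit hclosed
    have h' := h Y DY 𝒟 hmax N f hpb hf ν hν hunit hclosed
    rwa [LorentzianMetric.futureCauchyDevelopment_eq_self_of_isClosed _ _ hclosed] at h'
  · intro h Y _ _ _ _ _ _ DY 𝒟 hmax _ N _ _ _ f hpb hf ν hν hunit hclosed
    have h' := h Y DY 𝒟 hmax N f hpb hf ν hν hunit hclosed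
    rwa [LorentzianMetric.futureCauchyDevelopment_eq_self_of_isClosed _ _ hclosed]

end Summit.FinalStateConjecture.FinalStateConjecture.Cruxes.TameCensorship.CrushTheSwallowedInterior.NegativeNotes

end
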